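import Summits.HodgeConjecture.HodgeConjecture.Theses.SignSymmetricPowers

/-!
# Route SignSymmetricPowers — `Assembly` (assembly item stmt-HodgeConjecture-19719)

The assembly item of route `SignSymmetricPowers`,

  VeryGeneralSignCommutatorsInHg → PowersHodgeOfSignCommutators → SectorComplement → _root_.HodgeConjecture,

is the route's deciding theorem `SignSymmetricPowers.closes` curried (its hypotheses are exactly the route
items named in the item, in the same order).  Pure logic over the route file; no other import, no
named-fact hypothesis, no sorry.  Honest framing: this is the declared-sector IMPLICATION only — K1
`VeryGeneralSignCommutatorsInHg` (stmt-HodgeConjecture-19716) is proved in the tree only modulo nine named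
facts (`SignSymmetricPowersVeryGeneralSignCommutatorsInHg.veryGeneralSignCommutatorsInHg_of_facts`) and
`SectorComplement` is the declared residual; nothing here asserts the Hodge conjecture or the rung leaf.
-/

-- `Summit.HodgeConjecture.HodgeConjecture.Theorems` is the mandated namespace (single-problem
-- summit: Problem = Summit), which `linter.dupNamespace` flags on every declaration.
set_option linter.dupNamespace false

namespace Summit.HodgeConjecture.HodgeConjecture.Theorems

/-- **Item stmt-HodgeConjecture-19719 (`Assembly`), route `SignSymmetricPowers`**: the route's items
(K1 sign commutators in the Hodge group for very general ι-even threefolds, K2 the Hodge conjecture on all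
powers given those commutators, and the declared sector complement) imply the Hodge conjecture — literally
the deciding theorem `SignSymmetricPowers.closes`, curried.  The type is the route decl
`Summit.HodgeConjecture.HodgeConjecture.Theses.SignSymmetricPowers.Assembly`. -/
theorem signSymmetricPowers_assembly_proof :
    Summit.HodgeConjecture.HodgeConjecture.Theses.SignSymmetricPowers.Assembly :=
  fun h₁ h₂ h₃ ↦
    Summit.HodgeConjecture.HodgeConjecture.Theses.SignSymmetricPowers.closes h₁ h₂ h₃

end Summit.HodgeConjecture.HodgeConjecture.Theorems
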